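import Summits.AtomisticToContinuum.FouriersLaw.Theorems.LocalOhmBVLocalOhmStubFiniteResponsePackageAux1
import Summits.AtomisticToContinuum.FouriersLaw.Theorems.ParityLiouvilleSeedWindowLimitWindowGenerator
import Summits.AtomisticToContinuum.FouriersLaw.Theorems.ParityLiouvilleSeedWindowLimitStationarity
import Summits.AtomisticToContinuum.FouriersLaw.Theorems.BondHeatUncertaintyLightConeBondHeatGibbsByParts
import Literature.MathematicalPhysics.KineticTheory.LangevinChainNESSProofs

/-!
# `Cov_{μ_T}(𝒜F, H_N) = 0` for bulk cylinder observables; Gibbs integrability of polynomially bounded observables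

Helper for stub `stub_equilibriumPackage` (S2b; clauses (b1) finite-`N` and (b2c)) of the birth line of crux
`LocalOhmBV.LocalOhm` (item stmt-AtomisticToContinuum-12009). (b1) a continuous `ψ` with
`|ψ(z)| ≤ C₀ (1 + ‖z‖)^m` is integrable under `μ_T = gibbsMeasure N T` of the pinned chain, and so is `ψ · H_N`
(coercivity `‖z‖² ≤ C H_N(z)`, integrability of `(1 + H_N)^k e^{-H_N/T}`). (b2c) for a `C¹` cylinder profile `G`
with polynomially bounded value and derivative read on a bulk window (finite sites `a + c, …, a + c + n` in
`[1, N-2]`) through `embed N c`, `𝒜(G ∘ boxRestrictAt a n)` at the embedded configuration has zero covariance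
with `H_N` in `μ_T`; in fact `∫ 𝒜F dμ_T = 0` and `∫ 𝒜F · H_N dμ_T = 0`: `𝒜F = X_{H_N}(F ∘ embed)` there (the
window does not read the bath momenta), and for the weights `W = e^{-H/T}`, `H e^{-H/T}` two integrations by
parts per site give `∫ (p_j ∂_{q_j}F - ∂_{q_j}H ∂_{p_j}F) W = 0`. Folklore (Liouville); no definitions.
-/

set_option autoImplicit false

noncomputable section

namespace Summit.AtomisticToContinuum.FouriersLaw.Theorems.LocalOhmBirth

open MeasureTheory
open Literature.MathematicalPhysics.KineticTheory Literature.MathematicalPhysics.KineticTheory.HeatConduction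
open Summit.AtomisticToContinuum.FouriersLaw.Theorems.SubdiffusiveBondHeat
  (integral_mul_eq_neg_of_hasLineDerivAt_of_integrable)
open Summit.AtomisticToContinuum.FouriersLaw.Theorems.LightConeBondHeat
  (pinnedChain_integrable_mul_gibbsDensity_of_le_pow)
open Summit.AtomisticToContinuum.FouriersLaw.Theorems.WindowLimit

variable {N : ℕ}

/-- **Abstract Liouville identity for one site.** If a weight `W` has line derivatives `Dq` along
`(e_j, 0)` and `Dp` along `(0, e_j)` with `p_j Dq = ∂_{q_j}H · Dp` (true for `W = Ψ(H)`), then for a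
differentiable `F`, `∫ (p_j ∂_{q_j}F - ∂_{q_j}H ∂_{p_j}F) W = 0`, granted integrability of the five products
entering the two integrations by parts. [folklore] -/
theorem integral_liouvilleTerm_mul_eq_zero (P : OscillatorChain) {F : PhaseSpace N → ℝ}
    (hF : Differentiable ℝ F) (j : Fin N) {W Dq Dp : PhaseSpace N → ℝ}
    (hWq : ∀ x, HasLineDerivAt ℝ W (Dq x) x ((Pi.single j 1, 0) : PhaseSpace N))
    (hWp : ∀ x, HasLineDerivAt ℝ W (Dp x) x ((0, Pi.single j 1) : PhaseSpace N))
    (hx : ∀ x, x.2 j * Dq x = partialQ j (P.hamiltonian N) x * Dp x)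
    (h1 : Integrable fun x => x.2 j * Dq x * F x)
    (h2 : Integrable fun x => x.2 j * W x * partialQ j F x)
    (h3 : Integrable fun x => x.2 j * W x * F x)
    (h4 : Integrable fun x => partialQ j (P.hamiltonian N) x * W x * partialP j F x)
    (h5 : Integrable fun x => partialQ j (P.hamiltonian N) x * W x * F x) :
    ∫ x, (x.2 j * partialQ j F x - partialQ j (P.hamiltonian N) x * partialP j F x) * W x = 0 := by
  have e1 : ∫ x, x.2 j * W x * partialQ j F x = -∫ x, x.2 j * Dq x * F x := by
    refine integral_mul_eq_neg_of_hasLineDerivAt_of_integrable (F := fun x => x.2 j * W x)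
      (F' := fun x => x.2 j * Dq x) (g := F) (g' := partialQ j F)
      (v := ((Pi.single j 1, 0) : PhaseSpace N)) h1 h2 h3 (fun x => ?_) fun x => hasLineDerivAt_partialQ hF j x
    have h := hWq x
    unfold HasLineDerivAt at h ⊢
    simp only [add_smul_unitQ_snd]
    exact h.const_mul (x.2 j)
  have h1' : Integrable fun x => partialQ j (P.hamiltonian N) x * Dp x * F x := by
    refine h1.congr (Filter.Eventually.of_forall fun x => ?_)
    simp only [hx x]
  have e2 : ∫ x, partialQ j (P.hamiltonian N) x * W x * partialP j F x =
      -∫ x, partialQ j (P.hamiltonian N) x * Dp x * F x := by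
    refine integral_mul_eq_neg_of_hasLineDerivAt_of_integrable
      (F := fun x => partialQ j (P.hamiltonian N) x * W x)
      (F' := fun x => partialQ j (P.hamiltonian N) x * Dp x) (g := F) (g' := partialP j F)
      (v := ((0, Pi.single j 1) : PhaseSpace N)) h1' h4 h5 (fun x => ?_) fun x => hasLineDerivAt_partialP hF j x
    have h := hWp x
    unfold HasLineDerivAt at h ⊢
    simp only [OscillatorChain.partialQ_hamiltonian_add_smul_unitP]
    exact h.const_mul _
  rw [show (fun x => (x.2 j * partialQ j F x - partialQ j (P.hamiltonian N) x * partialP j F x) * W x) =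
      fun x => x.2 j * W x * partialQ j F x - partialQ j (P.hamiltonian N) x * W x * partialP j F x from
    funext fun x => by ring, integral_sub h2 h4, e1, e2]
  have h12 : (fun x => x.2 j * Dq x * F x) = fun x => partialQ j (P.hamiltonian N) x * Dp x * F x :=
    funext fun x => by rw [hx x]
  rw [h12]; ring

/-- Product rule for line derivatives of the weight `H · e^{-H/T}`. [folklore] -/
theorem hasLineDerivAt_hamiltonian_mul_gibbsDensity (P : OscillatorChain) {T D : ℝ} {x v : PhaseSpace N}
    (hH : HasLineDerivAt ℝ (P.hamiltonian N) D x v) :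
    HasLineDerivAt ℝ (fun y => P.hamiltonian N y * P.gibbsDensity N T y)
      (D * P.gibbsDensity N T x + P.hamiltonian N x * (-(D / T) * P.gibbsDensity N T x)) x v := by
  have hρ := P.hasLineDerivAt_gibbsDensity (T := T) hH
  unfold HasLineDerivAt at hH hρ ⊢
  have h := hH.mul hρ; simp only [zero_smul, add_zero] at h; exact h

section Pinned

variable {ω₂ lam β : ℝ}

/-- **`φ e^{-H/T}`, `φ H e^{-H/T} ∈ L¹(Lebesgue)` for polynomially bounded continuous `φ`** (pinned chain). [folklore] -/
theorem pinnedChain_integrable_mul_gibbsDensity_of_polyBound (hω : 0 < ω₂) (hl : 0 ≤ lam) (hβ : 0 ≤ β)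
    (γ : ℝ) (N : ℕ) {T : ℝ} (hT : 0 < T) {g : PhaseSpace N → ℝ} (hg : Continuous g) {C₀ : ℝ} {m : ℕ}
    (hle : ∀ x, |g x| ≤ C₀ * (1 + ‖x‖) ^ m) :
    Integrable (fun x => g x * (pinnedChain ω₂ lam β γ).gibbsDensity N T x) ∧
      Integrable (fun x => g x * (pinnedChain ω₂ lam β γ).hamiltonian N x *
        (pinnedChain ω₂ lam β γ).gibbsDensity N T x) := by
  set M : ℝ := max 2 (2 * max ω₂⁻¹ 1) with hM
  have hH0 : ∀ x : PhaseSpace N, 0 ≤ (pinnedChain ω₂ lam β γ).hamiltonian N x := fun x =>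
    pinnedChain_hamiltonian_nonneg hω.le hl hβ γ N x
  have hC0 : 0 ≤ C₀ := by
    have h := hle 0
    rw [norm_zero, add_zero, one_pow, mul_one] at h
    exact (abs_nonneg _).trans h
  have hM0 : 0 < M := lt_max_iff.2 (Or.inl two_pos)
  have hbound : ∀ x, |g x| ≤ C₀ * M ^ m * (1 + (pinnedChain ω₂ lam β γ).hamiltonian N x) ^ m := fun x =>
    (hle x).trans (by rw [mul_assoc]; exact mul_le_mul_of_nonneg_left (one_add_norm_pow_le_pow_mul hω hl hβ γ m x) hC0)
  have hHc : Continuous ((pinnedChain ω₂ lam β γ).hamiltonian N) := pinnedChain_continuous_hamiltonian ω₂ lam β γ N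
  refine ⟨pinnedChain_integrable_mul_gibbsDensity_of_le_pow hω hl hβ γ N hT m hg hbound,
    pinnedChain_integrable_mul_gibbsDensity_of_le_pow hω hl hβ γ N hT (m + 1) (hg.mul hHc)
      (C := C₀ * M ^ m) fun x => ?_⟩
  rw [abs_mul, abs_of_nonneg (hH0 x), pow_succ, ← mul_assoc]
  exact mul_le_mul (hbound x) (by linarith [hH0 x]) (hH0 x)
    (mul_nonneg (mul_nonneg hC0 (pow_nonneg hM0.le m)) (pow_nonneg (by linarith [hH0 x]) m))

/-- **(b1, finite `N`)** Gibbs integrability of polynomially bounded continuous `ψ` and of `ψ H_N`. [folklore] -/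
theorem pinnedChain_integrable_gibbsMeasure_of_polyBound (hω : 0 < ω₂) (hl : 0 ≤ lam) (hβ : 0 ≤ β)
    (γ : ℝ) (N : ℕ) {T : ℝ} (hT : 0 < T) (ψ : PhaseSpace N → ℝ) (hψ : Continuous ψ)
    (hb : ∃ (C₀ : ℝ) (m : ℕ), ∀ z, |ψ z| ≤ C₀ * (1 + ‖z‖) ^ m) :
    Integrable ψ ((pinnedChain ω₂ lam β γ).gibbsMeasure N T) ∧
      Integrable (fun z => ψ z * (pinnedChain ω₂ lam β γ).hamiltonian N z)
        ((pinnedChain ω₂ lam β γ).gibbsMeasure N T) := by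
  obtain ⟨C₀, m, hle⟩ := hb
  have h := pinnedChain_integrable_mul_gibbsDensity_of_polyBound hω hl hβ γ N hT hψ hle
  exact ⟨(pinnedChain ω₂ lam β γ).integrable_gibbsMeasure h.1, (pinnedChain ω₂ lam β γ).integrable_gibbsMeasure h.2⟩

/-- Products of polynomially bounded functions are polynomially bounded. [folklore] -/
theorem polyBound_mul {φ ψ : PhaseSpace N → ℝ} (hφ : ∃ (C : ℝ) (m : ℕ), ∀ x, |φ x| ≤ C * (1 + ‖x‖) ^ m)
    (hψ : ∃ (C : ℝ) (m : ℕ), ∀ x, |ψ x| ≤ C * (1 + ‖x‖) ^ m) :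
    ∃ (C : ℝ) (m : ℕ), ∀ x, |φ x * ψ x| ≤ C * (1 + ‖x‖) ^ m := by
  obtain ⟨C, m, hC⟩ := hφ
  obtain ⟨D, k, hD⟩ := hψ
  refine ⟨|C| * |D|, m + k, fun x => ?_⟩
  have h1 : |φ x| ≤ |C| * (1 + ‖x‖) ^ m :=
    (hC x).trans (mul_le_mul_of_nonneg_right (le_abs_self C) (by positivity))
  have h2 : |ψ x| ≤ |D| * (1 + ‖x‖) ^ k :=
    (hD x).trans (mul_le_mul_of_nonneg_right (le_abs_self D) (by positivity))
  rw [abs_mul, pow_add]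
  exact (mul_le_mul h1 h2 (abs_nonneg _) (by positivity)).trans_eq (by ring)

end Pinned

/-- The unit coordinate directions of phase space have norm `≤ 1`. [folklore] -/
theorem norm_unitQ_le_one (j : Fin N) : ‖((Pi.single j 1, 0) : PhaseSpace N)‖ ≤ 1 ∧
    ‖((0, Pi.single j 1) : PhaseSpace N)‖ ≤ 1 := by
  have h : ‖(Pi.single j (1 : ℝ) : Fin N → ℝ)‖ ≤ 1 := by rw [Pi.norm_single, norm_one]
  exact ⟨by rw [Prod.norm_def, norm_zero]; exact max_le h zero_le_one,
    by rw [Prod.norm_def, norm_zero]; exact max_le zero_le_one h⟩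

/-- The window map as a continuous linear map of norm `≤ 1`. [folklore] -/
theorem exists_windowCLM (N a' n : ℕ) (h : a' + (n + 1) ≤ N) :
    ∃ L : PhaseSpace N →L[ℝ] (Fin (n + 1) → ℝ × ℝ), (∀ x, L x = windowMap N a' n h x) ∧ ‖L‖ ≤ 1 := by
  refine ⟨ContinuousLinearMap.pi fun i : Fin (n + 1) =>
      ((ContinuousLinearMap.proj (R := ℝ) (Fin.castLE h (Fin.natAdd a' i))).comp
          (ContinuousLinearMap.fst ℝ (Fin N → ℝ) (Fin N → ℝ))).prod
        ((ContinuousLinearMap.proj (R := ℝ) (Fin.castLE h (Fin.natAdd a' i))).comp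
          (ContinuousLinearMap.snd ℝ (Fin N → ℝ) (Fin N → ℝ))), ?_, ?_⟩
  · intro x; rfl
  · refine ContinuousLinearMap.opNorm_le_bound _ zero_le_one fun x => ?_
    rw [one_mul]
    exact norm_windowMap_le N a' n h x

/-- Value and partial derivatives of a bulk-window observable with `C¹` polynomially bounded profile are
polynomially bounded. [folklore] -/
theorem polyBound_window {a : ℤ} {n : ℕ} {N c : ℕ} (h0 : 0 ≤ a + c) (hN : a + c + n < N)
    {G : (Fin (n + 1) → ℝ × ℝ) → ℝ} (hG : ContDiff ℝ 1 G)
    (hGb : ∃ (C₀ : ℝ) (m : ℕ), ∀ y, |G y| ≤ C₀ * (1 + ‖y‖) ^ m ∧ ‖fderiv ℝ G y‖ ≤ C₀ * (1 + ‖y‖) ^ m) :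
    (∃ (C : ℝ) (m : ℕ), ∀ x : PhaseSpace N, |((G ∘ boxRestrictAt a n) ∘ embed N c) x| ≤ C * (1 + ‖x‖) ^ m) ∧
    (∀ j : Fin N, ∃ (C : ℝ) (m : ℕ), ∀ x : PhaseSpace N,
      |partialQ j ((G ∘ boxRestrictAt a n) ∘ embed N c) x| ≤ C * (1 + ‖x‖) ^ m) ∧
    (∀ j : Fin N, ∃ (C : ℝ) (m : ℕ), ∀ x : PhaseSpace N,
      |partialP j ((G ∘ boxRestrictAt a n) ∘ embed N c) x| ≤ C * (1 + ‖x‖) ^ m) := by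
  obtain ⟨C₀, m, hb⟩ := hGb
  have hC0 : 0 ≤ C₀ := by
    have h := (hb 0).1
    rw [norm_zero, add_zero, one_pow, mul_one] at h
    exact (abs_nonneg _).trans h
  have hle : (a + c).toNat + (n + 1) ≤ N := by omega
  obtain ⟨L, hL, hL1⟩ := exists_windowCLM N (a + c).toNat n hle
  set F := (G ∘ boxRestrictAt a n) ∘ embed N c with hFdef
  have hFL : F = G ∘ ⇑L := by
    rw [hFdef, comp_box_comp_embed_eq (a' := (a + c).toNat) (by omega) hle G]
    funext x
    simp only [Function.comp_apply, hL x]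
  have hLx : ∀ x : PhaseSpace N, ‖L x‖ ≤ ‖x‖ := fun x => (L.le_opNorm x).trans (by nlinarith [norm_nonneg x])
  have hmono : ∀ x : PhaseSpace N, C₀ * (1 + ‖L x‖) ^ m ≤ C₀ * (1 + ‖x‖) ^ m := fun x =>
    mul_le_mul_of_nonneg_left (pow_le_pow_left₀ (by positivity) (by linarith [hLx x]) m) hC0
  have hGd : Differentiable ℝ G := hG.differentiable one_ne_zero
  have hFd : Differentiable ℝ F := by rw [hFL]; exact hGd.comp L.differentiable
  have hfd : ∀ x, fderiv ℝ F x = (fderiv ℝ G (L x)).comp (L : PhaseSpace N →L[ℝ] _) := fun x => by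
    rw [hFL]
    exact ((hGd (L x)).hasFDerivAt.comp x L.hasFDerivAt).fderiv
  have hfdn : ∀ x, ‖fderiv ℝ F x‖ ≤ C₀ * (1 + ‖x‖) ^ m := fun x => by
    rw [hfd x]
    calc ‖(fderiv ℝ G (L x)).comp L‖ ≤ ‖fderiv ℝ G (L x)‖ * ‖L‖ := ContinuousLinearMap.opNorm_comp_le _ _
      _ ≤ C₀ * (1 + ‖L x‖) ^ m * 1 :=
          mul_le_mul (hb (L x)).2 hL1 (norm_nonneg _) (by positivity)
      _ ≤ C₀ * (1 + ‖x‖) ^ m := by rw [mul_one]; exact hmono x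
  have hdir : ∀ (v : PhaseSpace N), ‖v‖ ≤ 1 → ∀ x, |fderiv ℝ F x v| ≤ C₀ * (1 + ‖x‖) ^ m := fun v hv x =>
    calc |fderiv ℝ F x v| = ‖fderiv ℝ F x v‖ := (Real.norm_eq_abs _).symm
      _ ≤ ‖fderiv ℝ F x‖ * ‖v‖ := ContinuousLinearMap.le_opNorm _ _
      _ ≤ C₀ * (1 + ‖x‖) ^ m * 1 := mul_le_mul (hfdn x) hv (norm_nonneg _) (by positivity)
      _ = _ := mul_one _
  refine ⟨⟨C₀, m, fun x => ?_⟩, fun j => ⟨C₀, m, fun x => ?_⟩, fun j => ⟨C₀, m, fun x => ?_⟩⟩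
  · rw [hFL, Function.comp_apply]
    exact (hb (L x)).1.trans (hmono x)
  · rw [partialQ_eq_fderiv hFd j]
    exact hdir _ (norm_unitQ_le_one j).1 x
  · rw [partialP_eq_fderiv hFd j]
    exact hdir _ (norm_unitQ_le_one j).2 x

/-- For a bulk window (finite sites in `[1, N-2]`), `𝒜(G ∘ box)(embed x) = X_{H_N}((G ∘ box) ∘ embed)(x)`
(the bath part of the generator does not see the window). [folklore] -/
theorem liouvilleZ_window_embed_eq_sum (P : OscillatorChain) (hU : Differentiable ℝ P.U)
    (hV : Differentiable ℝ P.V) {a : ℤ} {n : ℕ} {N c : ℕ} (hc : 1 ≤ a + c) (hN : a + c + n + 2 ≤ N)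
    (G : (Fin (n + 1) → ℝ × ℝ) → ℝ) (x : PhaseSpace N) :
    liouvilleZ P (G ∘ boxRestrictAt a n) (embed N c x) =
      ∑ j : Fin N, (x.2 j * partialQ j ((G ∘ boxRestrictAt a n) ∘ embed N c) x -
        partialQ j (P.hamiltonian N) x * partialP j ((G ∘ boxRestrictAt a n) ∘ embed N c) x) := by
  rw [← generator_comp_embed_eq_liouvilleZ P hU hV 0 0 hc hN G x]
  unfold OscillatorChain.generator
  have hbath : ∑ i : Fin N,
      ((if i.val = 0 then 0 * partialP i (partialP i ((G ∘ boxRestrictAt a n) ∘ embed N c)) x -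
          x.2 i * partialP i ((G ∘ boxRestrictAt a n) ∘ embed N c) x else 0) +
        (if i.val = N - 1 then 0 * partialP i (partialP i ((G ∘ boxRestrictAt a n) ∘ embed N c)) x -
          x.2 i * partialP i ((G ∘ boxRestrictAt a n) ∘ embed N c) x else 0)) = 0 := by
    refine Finset.sum_eq_zero fun i _ => ?_
    by_cases hi0 : i.val = 0 <;> by_cases hi1 : i.val = N - 1 <;>
      simp [hi0, hi1, partialP_comp_embed_eq_zero_of_bath hc hN G i]
  rw [hbath, mul_zero, add_zero]

section Pinned

variable {ω₂ lam β : ℝ}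

/-- **Liouville against `e^{-H/T}` and `H e^{-H/T}` for a bulk-window observable of the pinned chain.** [folklore] -/
theorem integral_liouvilleZ_window_mul_weights_eq_zero (γ : ℝ) (hω : 0 < ω₂) (hl : 0 ≤ lam) (hβ : 0 ≤ β)
    {T : ℝ} (hT : 0 < T) {N : ℕ} {a : ℤ} {n c : ℕ} (hc : 1 ≤ a + c) (hN : a + c + n + 2 ≤ N)
    {G : (Fin (n + 1) → ℝ × ℝ) → ℝ} (hG : ContDiff ℝ 1 G)
    (hGb : ∃ (C₀ : ℝ) (m : ℕ), ∀ y, |G y| ≤ C₀ * (1 + ‖y‖) ^ m ∧ ‖fderiv ℝ G y‖ ≤ C₀ * (1 + ‖y‖) ^ m) :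
    (Integrable (fun x => liouvilleZ (pinnedChain ω₂ lam β γ) (G ∘ boxRestrictAt a n) (embed N c x) *
        (pinnedChain ω₂ lam β γ).gibbsDensity N T x) ∧
      ∫ x, liouvilleZ (pinnedChain ω₂ lam β γ) (G ∘ boxRestrictAt a n) (embed N c x) *
        (pinnedChain ω₂ lam β γ).gibbsDensity N T x = 0) ∧
    (Integrable (fun x => liouvilleZ (pinnedChain ω₂ lam β γ) (G ∘ boxRestrictAt a n) (embed N c x) *
        (pinnedChain ω₂ lam β γ).hamiltonian N x * (pinnedChain ω₂ lam β γ).gibbsDensity N T x) ∧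
      ∫ x, liouvilleZ (pinnedChain ω₂ lam β γ) (G ∘ boxRestrictAt a n) (embed N c x) *
        (pinnedChain ω₂ lam β γ).hamiltonian N x * (pinnedChain ω₂ lam β γ).gibbsDensity N T x = 0) := by
  set P := pinnedChain ω₂ lam β γ with hP
  set F : PhaseSpace N → ℝ := (G ∘ boxRestrictAt a n) ∘ embed N c with hFdef
  set H : PhaseSpace N → ℝ := P.hamiltonian N with hHdef
  set ρ : PhaseSpace N → ℝ := P.gibbsDensity N T with hρdef
  have hU : Differentiable ℝ P.U := (pinnedChain_contDiff_U ω₂ lam β γ (n := 1)).differentiable one_ne_zero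
  have hV : Differentiable ℝ P.V := (pinnedChain_contDiff_V ω₂ lam β γ (n := 1)).differentiable one_ne_zero
  have hH1 : ContDiff ℝ 1 H := pinnedChain_contDiff_hamiltonian ω₂ lam β γ N (n := 1)
  have hHd : Differentiable ℝ H := hH1.differentiable one_ne_zero
  have hHc : Continuous H := hH1.continuous
  have hρc : Continuous ρ := pinnedChain_continuous_gibbsDensity ω₂ lam β γ N T
  have hF1 : ContDiff ℝ 1 F := contDiff_comp_embed (by omega) (by omega) hG
  have hFd : Differentiable ℝ F := hF1.differentiable one_ne_zero
  have hFc : Continuous F := hF1.continuous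
  obtain ⟨hbF, hbQ, hbP⟩ := polyBound_window (N := N) (c := c) (a := a) (n := n) (by omega) (by omega) hG hGb
  have hint : ∀ {φ : PhaseSpace N → ℝ}, Continuous φ → (∃ (C : ℝ) (m : ℕ), ∀ x, |φ x| ≤ C * (1 + ‖x‖) ^ m) →
      Integrable (fun x => φ x * ρ x) ∧ Integrable (fun x => φ x * H x * ρ x) := fun hφ hb => by
    obtain ⟨C, m, hle⟩ := hb
    exact pinnedChain_integrable_mul_gibbsDensity_of_polyBound hω hl hβ γ N hT hφ hle
  have hWc : ∀ j : Fin N, Continuous (partialQ j H) := fun j => P.continuous_partialQ_hamiltonian hH1 j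
  have hQc : ∀ j : Fin N, Continuous (partialQ j F) := fun j => continuous_partialQ hF1 one_ne_zero j
  have hPc : ∀ j : Fin N, Continuous (partialP j F) := fun j => continuous_partialP hF1 one_ne_zero j
  have hpc : ∀ j : Fin N, Continuous fun x : PhaseSpace N => x.2 j := fun j =>
    (continuous_apply j).comp continuous_snd
  have hsite : ∀ j : Fin N,
      (Integrable (fun x => (x.2 j * partialQ j F x - partialQ j H x * partialP j F x) * ρ x) ∧
        ∫ x, (x.2 j * partialQ j F x - partialQ j H x * partialP j F x) * ρ x = 0) ∧
      (Integrable (fun x => (x.2 j * partialQ j F x - partialQ j H x * partialP j F x) * (H x * ρ x)) ∧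
        ∫ x, (x.2 j * partialQ j F x - partialQ j H x * partialP j F x) * (H x * ρ x) = 0) := by
    intro j
    have bp : ∃ (C : ℝ) (m : ℕ), ∀ x : PhaseSpace N, |x.2 j| ≤ C * (1 + ‖x‖) ^ m :=
      ⟨1, 1, fun x => by rw [one_mul, pow_one]; exact (abs_coord_le_norm x j).2.trans (by linarith [norm_nonneg x])⟩
    have bW : ∃ (C : ℝ) (m : ℕ), ∀ x : PhaseSpace N, |partialQ j H x| ≤ C * (1 + ‖x‖) ^ m :=
      ⟨_, 3, fun x => pinnedChain_abs_partialQ_hamiltonian_le ω₂ lam β γ x j⟩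
    have iA := hint ((hpc j).mul (hQc j)) (polyBound_mul bp (hbQ j))           -- p_j ∂_qF
    have iB := hint ((hpc j).mul hFc) (polyBound_mul bp hbF)                     -- p_j F
    have iC := hint ((hWc j).mul (hPc j)) (polyBound_mul bW (hbP j))           -- ∂_jH ∂_pF
    have iD := hint ((hWc j).mul hFc) (polyBound_mul bW hbF)                     -- ∂_jH F
    have iE := hint (((hpc j).mul (hWc j)).mul hFc) (polyBound_mul (polyBound_mul bp bW) hbF) -- p_j ∂_jH F
    refine ⟨⟨?_, ?_⟩, ?_, ?_⟩
    · refine (iA.1.sub iC.1).congr (Filter.Eventually.of_forall fun x => ?_)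
      simp only [Pi.sub_apply, Pi.mul_apply, hHdef]; ring
    · refine integral_liouvilleTerm_mul_eq_zero P hFd j (W := ρ)
        (Dq := fun x => -(partialQ j H x / T) * ρ x) (Dp := fun x => -(x.2 j / T) * ρ x)
        (fun x => P.hasLineDerivAt_gibbsDensity (P.hasLineDerivAt_hamiltonian_unitQ hHd x j))
        (fun x => P.hasLineDerivAt_gibbsDensity (P.hasLineDerivAt_hamiltonian_unitP N x j))
        (fun x => by ring) ?_ ?_ ?_ ?_ ?_
      · refine ((iE.1).const_mul (-T⁻¹)).congr (Filter.Eventually.of_forall fun x => ?_)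
        simp only [Pi.mul_apply, hHdef]; ring
      · exact iA.1.congr (Filter.Eventually.of_forall fun x => by simp only [Pi.mul_apply]; ring)
      · exact iB.1.congr (Filter.Eventually.of_forall fun x => by simp only [Pi.mul_apply]; ring)
      · exact iC.1.congr (Filter.Eventually.of_forall fun x => by simp only [Pi.mul_apply, hHdef]; ring)
      · exact iD.1.congr (Filter.Eventually.of_forall fun x => by simp only [Pi.mul_apply, hHdef]; ring)
    · refine (iA.2.sub iC.2).congr (Filter.Eventually.of_forall fun x => ?_)
      simp only [Pi.sub_apply, Pi.mul_apply, hHdef]; ring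
    · refine integral_liouvilleTerm_mul_eq_zero P hFd j (W := fun x => H x * ρ x)
        (Dq := fun x => partialQ j H x * ρ x + H x * (-(partialQ j H x / T) * ρ x))
        (Dp := fun x => x.2 j * ρ x + H x * (-(x.2 j / T) * ρ x))
        (fun x => hasLineDerivAt_hamiltonian_mul_gibbsDensity P (P.hasLineDerivAt_hamiltonian_unitQ hHd x j))
        (fun x => hasLineDerivAt_hamiltonian_mul_gibbsDensity P (P.hasLineDerivAt_hamiltonian_unitP N x j))
        (fun x => by ring) ?_ ?_ ?_ ?_ ?_
      · refine (iE.1.add ((iE.2).const_mul (-T⁻¹))).congr (Filter.Eventually.of_forall fun x => ?_)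
        simp only [Pi.add_apply, Pi.mul_apply, hHdef]; ring
      · exact iA.2.congr (Filter.Eventually.of_forall fun x => by simp only [Pi.mul_apply, hHdef]; ring)
      · exact iB.2.congr (Filter.Eventually.of_forall fun x => by simp only [Pi.mul_apply, hHdef]; ring)
      · exact iC.2.congr (Filter.Eventually.of_forall fun x => by simp only [Pi.mul_apply, hHdef]; ring)
      · exact iD.2.congr (Filter.Eventually.of_forall fun x => by simp only [Pi.mul_apply, hHdef]; ring)
  have hsum : ∀ x, liouvilleZ P (G ∘ boxRestrictAt a n) (embed N c x) =
      ∑ j : Fin N, (x.2 j * partialQ j F x - partialQ j H x * partialP j F x) := fun x =>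
    liouvilleZ_window_embed_eq_sum P hU hV hc hN G x
  refine ⟨⟨?_, ?_⟩, ?_, ?_⟩
  · have h := integrable_finsetSum Finset.univ fun j (_ : j ∈ Finset.univ) => (hsite j).1.1
    refine h.congr (Filter.Eventually.of_forall fun x => ?_)
    simp only [hsum x, Finset.sum_mul]
  · simp_rw [hsum, Finset.sum_mul]
    rw [integral_finsetSum Finset.univ fun j _ => (hsite j).1.1]
    exact Finset.sum_eq_zero fun j _ => (hsite j).1.2
  · have h := integrable_finsetSum Finset.univ fun j (_ : j ∈ Finset.univ) => (hsite j).2.1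
    refine h.congr (Filter.Eventually.of_forall fun x => ?_)
    simp only [hsum x, Finset.sum_mul, mul_assoc]
  · simp_rw [hsum, Finset.sum_mul, mul_assoc]
    rw [integral_finsetSum Finset.univ fun j _ => (hsite j).2.1]
    exact Finset.sum_eq_zero fun j _ => (hsite j).2.2

/-- **(b2c) `Cov_{μ_T}(𝒜F, H_N) = 0` for bulk `C¹` cylinder observables of polynomial growth** (pinned chain,
`ω₂ > 0`, `lam, β ≥ 0`, `T > 0`; window at finite sites in `[1, N-2]`). [folklore] -/
theorem cov_liouvilleZ_window_hamiltonian_gibbsMeasure (γ : ℝ) (hω : 0 < ω₂) (hl : 0 ≤ lam) (hβ : 0 ≤ β)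
    {T : ℝ} (hT : 0 < T) (N : ℕ) (a : ℤ) (n c : ℕ) (hc : 1 ≤ a + c) (hN : a + c + n + 2 ≤ N)
    (G : (Fin (n + 1) → ℝ × ℝ) → ℝ) (hG : ContDiff ℝ 1 G)
    (hGb : ∃ (C₀ : ℝ) (m : ℕ), ∀ y, |G y| ≤ C₀ * (1 + ‖y‖) ^ m ∧ ‖fderiv ℝ G y‖ ≤ C₀ * (1 + ‖y‖) ^ m) :
    (∫ z, liouvilleZ (pinnedChain ω₂ lam β γ) (G ∘ boxRestrictAt a n) (embed N c z) *
        (pinnedChain ω₂ lam β γ).hamiltonian N z ∂((pinnedChain ω₂ lam β γ).gibbsMeasure N T)) -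
      (∫ z, liouvilleZ (pinnedChain ω₂ lam β γ) (G ∘ boxRestrictAt a n) (embed N c z)
          ∂((pinnedChain ω₂ lam β γ).gibbsMeasure N T)) *
        (∫ z, (pinnedChain ω₂ lam β γ).hamiltonian N z ∂((pinnedChain ω₂ lam β γ).gibbsMeasure N T)) =
      0 := by
  obtain ⟨⟨-, h0⟩, -, h1⟩ := integral_liouvilleZ_window_mul_weights_eq_zero γ hω hl hβ hT hc hN hG hGb
  rw [(pinnedChain ω₂ lam β γ).integral_gibbsMeasure
      (fun z => liouvilleZ (pinnedChain ω₂ lam β γ) (G ∘ boxRestrictAt a n) (embed N c z) *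
        (pinnedChain ω₂ lam β γ).hamiltonian N z),
    (pinnedChain ω₂ lam β γ).integral_gibbsMeasure
      (fun z => liouvilleZ (pinnedChain ω₂ lam β γ) (G ∘ boxRestrictAt a n) (embed N c z)), h0, h1]
  ring

/-- **Registered sub-goal (clauses (b1) finite-`N` and (b2c) of `stub_equilibriumPackage`).** [folklore] -/
theorem equilibriumPackage_covLiouvilleEnergy :
    ∀ ω₂ lam β γ : ℝ, 0 < ω₂ → 0 ≤ lam → 0 ≤ β → ∀ T : ℝ, 0 < T →
      (∀ (N : ℕ) (ψ : PhaseSpace N → ℝ), Continuous ψ →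
        (∃ (C₀ : ℝ) (m : ℕ), ∀ z, |ψ z| ≤ C₀ * (1 + ‖z‖) ^ m) →
        Integrable ψ ((pinnedChain ω₂ lam β γ).gibbsMeasure N T) ∧
          Integrable (fun z => ψ z * (pinnedChain ω₂ lam β γ).hamiltonian N z)
            ((pinnedChain ω₂ lam β γ).gibbsMeasure N T)) ∧
      (∀ (N : ℕ) (a : ℤ) (n c : ℕ), 1 ≤ a + c → a + c + n + 2 ≤ N →
        ∀ G : (Fin (n + 1) → ℝ × ℝ) → ℝ, ContDiff ℝ 1 G →
        (∃ (C₀ : ℝ) (m : ℕ), ∀ y, |G y| ≤ C₀ * (1 + ‖y‖) ^ m ∧ ‖fderiv ℝ G y‖ ≤ C₀ * (1 + ‖y‖) ^ m) →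
        (∫ z, liouvilleZ (pinnedChain ω₂ lam β γ) (G ∘ boxRestrictAt a n) (embed N c z) *
            (pinnedChain ω₂ lam β γ).hamiltonian N z ∂((pinnedChain ω₂ lam β γ).gibbsMeasure N T)) -
          (∫ z, liouvilleZ (pinnedChain ω₂ lam β γ) (G ∘ boxRestrictAt a n) (embed N c z)
              ∂((pinnedChain ω₂ lam β γ).gibbsMeasure N T)) *
            (∫ z, (pinnedChain ω₂ lam β γ).hamiltonian N z ∂((pinnedChain ω₂ lam β γ).gibbsMeasure N T)) =
          0) :=
  fun _ω₂ _lam _β γ hω hl hβ _T hT =>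
    ⟨fun N ψ hψ hb => pinnedChain_integrable_gibbsMeasure_of_polyBound hω hl hβ γ N hT ψ hψ hb,
      fun N a n c hc hN G hG hGb => cov_liouvilleZ_window_hamiltonian_gibbsMeasure γ hω hl hβ hT N a n c hc hN G hG hGb⟩

end Pinned

end Summit.AtomisticToContinuum.FouriersLaw.Theorems.LocalOhmBirth

end
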